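import Mathlib
import HarnessLib
import Literature.Analysis.FluidPDE.VectorCalculus
import Summits.NavierStokesRegularity.NavierStokesRegularity.Theorems.AxisTwistDoorAveragedConeLiouvilleDefs

/-!
# Crux `AxisTwistDoor.AveragedConeLiouville` (stmt-NavierStokesRegularity-26889), line `lrt_shell` (LEAD ns-atd-p1 g0): brick C7 —
# CLASSICAL PROPAGATION OF POSITIVITY ON ARBITRARY PARABOLIC CYLINDERS

The line's `PositivityPropagationFactC` (the classical closed-cylinder form of Nazarov–Ural'tseva 2011 Cor. 3.2 = Lei–Ren–Tian
arXiv:2501.08976 Lemma 2.5, landed as stub (4′) from the typed named fact) is stated on the unit cylinder `(0,T) × B(0,1)`.  The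
Harnack chain of stub (5b) applies it at many centres and scales; this file provides the translated and parabolically rescaled
form `factC_on_cylinder`: on `(t₀, t₀ + ρ²T) × B(x₀, ρ)` with drift bound `Λ/ρ`, measure level `δρ³` at a time
`t̄ ∈ (t₀, t₀ + ρ²T/3)`, the conclusion `V ≥ βλ` holds on `(t₀ + ρ²T/2, t₀ + ρ²T) × B(x₀, rρ)` with the SAME `β = β(δ,T,r,Λ)`.
The proof is the substitution `V'(s,y) = V(t₀ + ρ²s, x₀ + ρy)`, `b'(s,y) = ρ b(t₀ + ρ²s, x₀ + ρy)` with the hypothesis-free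
rescaling rules `laplacian_comp_affine`, `gradient_comp_affine`, `divergence_smul_comp_affine`, `deriv_comp_time_affine` and
the volume rule `volume_preimage_affine`.

WHAT THIS IS NOT: not NS regularity, not the crux — a helper `--supports stmt-NavierStokesRegularity-26889 --as helper` (width seat
ns-cas-k2 g0); ACL 26889 and NS regularity are OPEN.  [cite: NazarovUraltseva2012, Cor. 3.2 (scale-invariant form)]
-/

noncomputable section

set_option linter.dupNamespace false

namespace Summit.NavierStokesRegularity.NavierStokesRegularity.Theorems.AveragedConeLiouville.PositivityCylinders

open scoped Topology InnerProductSpace Laplacian ENNReal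
open Set Function Filter MeasureTheory Metric
open Literature.Analysis Literature.Analysis.FluidPDE
open Summit.NavierStokesRegularity.NavierStokesRegularity.Theorems.AxisTwistDoorAveragedConeLiouvilleDefs

/-! ### Hypothesis-free rescaling rules under `y ↦ x₀ + ρ y` -/

section Generic

variable {E F : Type*} [NormedAddCommGroup E] [NormedSpace ℝ E] [NormedAddCommGroup F] [NormedSpace ℝ F]

/-- `D(k • f(c ·))(x) = (k c) • Df(c x)`, no differentiability hypothesis (Mathlib `fderiv_comp_smul`,
`fderiv_const_smul_field`). [folklore] -/
-- adapted from the tree's private `Chae2011.fderiv_const_smul_comp_smul_apply` (ChaeEulerLiouville.lean)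
theorem fderiv_const_smul_comp_smul_apply (f : E → F) (k c : ℝ) (x : E) :
    fderiv ℝ (fun y => k • f (c • y)) x = (k * c) • fderiv ℝ f (c • x) := by
  have h : (fun y => k • f (c • y)) = k • fun y => f (c • y) := rfl
  rw [h, fderiv_const_smul_field, Pi.smul_apply, _root_.fderiv_comp_smul, smul_smul]

/-- `D(k • f(x₀ + c ·))(y) = (k c) • Df(x₀ + c y)`, no differentiability hypothesis. [folklore] -/
theorem fderiv_const_smul_comp_affine (f : E → F) (x₀ : E) (k c : ℝ) (y : E) :
    fderiv ℝ (fun y => k • f (x₀ + c • y)) y = (k * c) • fderiv ℝ f (x₀ + c • y) := by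
  have h := fderiv_const_smul_comp_smul_apply (fun z => f (x₀ + z)) k c y
  rw [h, fderiv_comp_add_left]

/-- `D(f(x₀ + ρ ·))(y) = ρ • Df(x₀ + ρ y)`, no differentiability hypothesis. [folklore] -/
theorem fderiv_comp_affine (f : E → F) (x₀ : E) (ρ : ℝ) (y : E) :
    fderiv ℝ (fun y => f (x₀ + ρ • y)) y = ρ • fderiv ℝ f (x₀ + ρ • y) := by
  have h := fderiv_const_smul_comp_affine f x₀ 1 ρ y
  simpa only [one_smul, one_mul] using h

/-- `D²(f(x₀ + ρ ·)) = z ↦ ρ² • D²f(x₀ + ρ z)`, no differentiability hypothesis. [folklore] -/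
theorem fderiv_fderiv_comp_affine (f : E → F) (x₀ : E) (ρ : ℝ) :
    fderiv ℝ (fderiv ℝ fun y => f (x₀ + ρ • y)) = fun z => ρ ^ 2 • fderiv ℝ (fderiv ℝ f) (x₀ + ρ • z) := by
  have h1 : (fderiv ℝ fun y => f (x₀ + ρ • y)) = fun z => ρ • fderiv ℝ f (x₀ + ρ • z) :=
    funext (fderiv_comp_affine f x₀ ρ)
  rw [h1]
  funext z
  rw [fderiv_const_smul_comp_affine (fderiv ℝ f) x₀ ρ ρ z, sq]

end Generic

section Rules

variable {F : Type*} [NormedAddCommGroup F] [NormedSpace ℝ F]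

/-- `Δ f(x) = Σᵢ D²f(x)(eᵢ, eᵢ)` in the standard orthonormal frame, no differentiability hypothesis. [folklore] -/
-- adapted from the tree's private `Chae2011.laplacian_eq_sum_fderiv_fderiv`
theorem laplacian_eq_sum_fderiv_fderiv' (f : EuclideanSpace ℝ (Fin 3) → F) (x : EuclideanSpace ℝ (Fin 3)) :
    Δ f x = ∑ i, fderiv ℝ (fderiv ℝ f) x (stdOrthonormalBasis ℝ (EuclideanSpace ℝ (Fin 3)) i)
      (stdOrthonormalBasis ℝ (EuclideanSpace ℝ (Fin 3)) i) := by
  rw [InnerProductSpace.laplacian_eq_iteratedFDeriv_stdOrthonormalBasis]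
  simp only [iteratedFDeriv_two_apply]
  rfl

/-- `Δ(f(x₀ + ρ ·))(y) = ρ² • (Δf)(x₀ + ρ y)`, no differentiability hypothesis. [folklore] -/
theorem laplacian_comp_affine (f : EuclideanSpace ℝ (Fin 3) → F) (x₀ : EuclideanSpace ℝ (Fin 3)) (ρ : ℝ)
    (y : EuclideanSpace ℝ (Fin 3)) :
    Δ (fun y => f (x₀ + ρ • y)) y = ρ ^ 2 • Δ f (x₀ + ρ • y) := by
  rw [laplacian_eq_sum_fderiv_fderiv', laplacian_eq_sum_fderiv_fderiv', fderiv_fderiv_comp_affine, Finset.smul_sum]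
  rfl

/-- `∇(f(x₀ + ρ ·))(y) = ρ • (∇f)(x₀ + ρ y)`, no differentiability hypothesis. [folklore] -/
theorem gradient_comp_affine (f : EuclideanSpace ℝ (Fin 3) → ℝ) (x₀ : EuclideanSpace ℝ (Fin 3)) (ρ : ℝ)
    (y : EuclideanSpace ℝ (Fin 3)) :
    gradient (fun y => f (x₀ + ρ • y)) y = ρ • gradient f (x₀ + ρ • y) := by
  rw [gradient, gradient, fderiv_comp_affine, map_smul]

/-- `div (ρ b(x₀ + ρ ·))(y) = ρ² div b (x₀ + ρ y)`, no differentiability hypothesis. [folklore] -/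
theorem divergence_smul_comp_affine (b : EuclideanSpace ℝ (Fin 3) → EuclideanSpace ℝ (Fin 3)) (x₀ : EuclideanSpace ℝ (Fin 3))
    (ρ : ℝ) (y : EuclideanSpace ℝ (Fin 3)) :
    VectorCalculus.divergence (fun y => ρ • b (x₀ + ρ • y)) y = ρ ^ 2 * VectorCalculus.divergence b (x₀ + ρ • y) := by
  unfold VectorCalculus.divergence
  rw [fderiv_const_smul_comp_affine b x₀ ρ ρ y,
    show (((ρ * ρ) • fderiv ℝ b (x₀ + ρ • y) : EuclideanSpace ℝ (Fin 3) →L[ℝ] EuclideanSpace ℝ (Fin 3)) :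
        EuclideanSpace ℝ (Fin 3) →ₗ[ℝ] EuclideanSpace ℝ (Fin 3)) =
      (ρ * ρ) • ((fderiv ℝ b (x₀ + ρ • y) : EuclideanSpace ℝ (Fin 3) →L[ℝ] EuclideanSpace ℝ (Fin 3)) :
        EuclideanSpace ℝ (Fin 3) →ₗ[ℝ] EuclideanSpace ℝ (Fin 3)) from rfl,
    map_smul, smul_eq_mul, sq]

/-- `d/ds g(t₀ + c s) = c g'(t₀ + c s)`, no differentiability hypothesis. [folklore] -/
theorem deriv_comp_time_affine (g : ℝ → ℝ) (t₀ c s : ℝ) :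
    deriv (fun s => g (t₀ + c * s)) s = c * deriv g (t₀ + c * s) := by
  have h := deriv_comp_mul_left (f := fun σ => g (t₀ + σ)) (c := c) (x := s)
  rw [h, deriv_comp_const_add, smul_eq_mul]

/-- Volume of a preimage under `y ↦ x₀ + ρ y` (`ρ ≠ 0`): `|ρ³|⁻¹ · volume`. [folklore] -/
theorem volume_preimage_affine (x₀ : EuclideanSpace ℝ (Fin 3)) {ρ : ℝ} (hρ : ρ ≠ 0) (S : Set (EuclideanSpace ℝ (Fin 3))) :
    volume ((fun y : EuclideanSpace ℝ (Fin 3) => x₀ + ρ • y) ⁻¹' S) = ENNReal.ofReal (|ρ ^ 3|⁻¹) * volume S := by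
  have h : (fun y : EuclideanSpace ℝ (Fin 3) => x₀ + ρ • y) ⁻¹' S =
      (fun y : EuclideanSpace ℝ (Fin 3) => ρ • y) ⁻¹' ((fun z => x₀ + z) ⁻¹' S) := rfl
  rw [h, Measure.addHaar_preimage_smul volume hρ, measure_preimage_add, finrank_euclideanSpace_fin, abs_inv]

end Rules

/-! ### FactC on arbitrary cylinders -/

/-- **Classical propagation of positivity on the cylinder `(t₀, t₀ + ρ²T) × B(x₀, ρ)`** (translation + parabolic scaling of
`PositivityPropagationFactC`; `β = β(δ, T, r, Λ)` is the unit-cylinder constant, the drift bound is `Λ/ρ` and the measure level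
`δρ³`). [cite: NazarovUraltseva2012, Cor. 3.2 (scale-invariant form)] -/
theorem factC_on_cylinder (hC : PositivityPropagationFactC) :
    ∀ δ T r Λ : ℝ, 0 < δ → 0 < T → 0 < r → r < 1 → 0 ≤ Λ → ∃ β : ℝ, 0 < β ∧
      ∀ (V : ℝ → EuclideanSpace ℝ (Fin 3) → ℝ) (b : ℝ → EuclideanSpace ℝ (Fin 3) → EuclideanSpace ℝ (Fin 3))
        (U : Set (ℝ × EuclideanSpace ℝ (Fin 3))) (x₀ : EuclideanSpace ℝ (Fin 3)) (t₀ ρ : ℝ), 0 < ρ → IsOpen U →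
        Set.Icc t₀ (t₀ + ρ ^ 2 * T) ×ˢ Metric.closedBall x₀ ρ ⊆ U →
        ContDiffOn ℝ 2 (Function.uncurry V) U → ContDiffOn ℝ 1 (Function.uncurry b) U →
        (∀ t ∈ Set.Ioo t₀ (t₀ + ρ ^ 2 * T), ∀ x ∈ Metric.ball x₀ ρ, ‖b t x‖ ≤ Λ / ρ) →
        (∀ t ∈ Set.Ioo t₀ (t₀ + ρ ^ 2 * T), ∀ x ∈ Metric.ball x₀ ρ, VectorCalculus.divergence (b t) x = 0) →
        (∀ t ∈ Set.Ioo t₀ (t₀ + ρ ^ 2 * T), ∀ x ∈ Metric.ball x₀ ρ, 0 ≤ V t x) →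
        (∀ t ∈ Set.Ioo t₀ (t₀ + ρ ^ 2 * T), ∀ x ∈ Metric.ball x₀ ρ,
            0 ≤ deriv (fun τ => V τ x) t - (Δ (V t)) x + ⟪b t x, gradient (V t) x⟫_ℝ) →
        ∀ tbar lam : ℝ, t₀ < tbar → tbar < t₀ + ρ ^ 2 * T / 3 → 0 < lam →
          ENNReal.ofReal (δ * ρ ^ 3) ≤ volume {x : EuclideanSpace ℝ (Fin 3) | x ∈ Metric.ball x₀ ρ ∧ lam ≤ V tbar x} →
          ∀ t ∈ Set.Ioo (t₀ + ρ ^ 2 * T / 2) (t₀ + ρ ^ 2 * T), ∀ x ∈ Metric.ball x₀ (r * ρ), β * lam ≤ V t x := by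
  intro δ T r Λ hδ hT hr hr1 hΛ
  obtain ⟨β, hβ, hC⟩ := hC δ T r Λ hδ hT hr hr1 hΛ
  refine ⟨β, hβ, ?_⟩
  intro V b U x₀ t₀ ρ hρ hU hcyl hV hb hbd hdiv hpos hsup tbar lam htb htb' hlam hmeas t ht x hx
  -- the substitution
  set A : ℝ × EuclideanSpace ℝ (Fin 3) → ℝ × EuclideanSpace ℝ (Fin 3) := fun p => (t₀ + ρ ^ 2 * p.1, x₀ + ρ • p.2) with hA
  set V' : ℝ → EuclideanSpace ℝ (Fin 3) → ℝ := fun s y => V (t₀ + ρ ^ 2 * s) (x₀ + ρ • y) with hV'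
  set b' : ℝ → EuclideanSpace ℝ (Fin 3) → EuclideanSpace ℝ (Fin 3) := fun s y => ρ • b (t₀ + ρ ^ 2 * s) (x₀ + ρ • y)
    with hb'
  have hρ0 : ρ ≠ 0 := hρ.ne'
  have hρ2 : 0 < ρ ^ 2 := by positivity
  have hAc : ContDiff ℝ ⊤ A :=
    ((contDiff_const.add (contDiff_const.mul contDiff_fst)).prodMk (contDiff_const.add (contDiff_snd.const_smul ρ)))
  -- time and space correspondences
  have htime : ∀ s : ℝ, s ∈ Set.Ioo 0 T → t₀ + ρ ^ 2 * s ∈ Set.Ioo t₀ (t₀ + ρ ^ 2 * T) := fun s hs =>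
    ⟨by nlinarith [hs.1], by nlinarith [hs.2]⟩
  have hspace : ∀ y : EuclideanSpace ℝ (Fin 3), ∀ R : ℝ, y ∈ Metric.ball (0 : EuclideanSpace ℝ (Fin 3)) R →
      x₀ + ρ • y ∈ Metric.ball x₀ (R * ρ) := fun y R hy => by
    rw [mem_ball, dist_eq_norm, add_sub_cancel_left, norm_smul, Real.norm_eq_abs, abs_of_pos hρ, mul_comm]
    exact mul_lt_mul_of_pos_right (by simpa using hy) hρ
  have hspace1 : ∀ y : EuclideanSpace ℝ (Fin 3), y ∈ Metric.ball (0 : EuclideanSpace ℝ (Fin 3)) 1 →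
      x₀ + ρ • y ∈ Metric.ball x₀ ρ := fun y hy => by simpa using hspace y 1 hy
  -- apply the unit-cylinder fact to `V'`, `b'` on `U' = A ⁻¹' U`
  have key := hC V' b' (A ⁻¹' U) (hU.preimage hAc.continuous) ?_ ?_ ?_ ?_ ?_ ?_ ?_ ((tbar - t₀) / ρ ^ 2) lam ?_ ?_ hlam ?_
    ((t - t₀) / ρ ^ 2) ?_ (ρ⁻¹ • (x - x₀)) ?_
  · -- unfold the conclusion
    have e1 : t₀ + ρ ^ 2 * ((t - t₀) / ρ ^ 2) = t := by field_simp; ring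
    have e2 : x₀ + ρ • (ρ⁻¹ • (x - x₀)) = x := by rw [smul_smul, mul_inv_cancel₀ hρ0, one_smul, add_sub_cancel]
    simpa [hV', e1, e2] using key
  · -- closed cylinder inside `U'`
    rintro ⟨s, y⟩ ⟨hs, hy⟩
    refine hcyl ⟨⟨by nlinarith [hs.1], by nlinarith [hs.2]⟩, ?_⟩
    rw [mem_closedBall, dist_eq_norm, add_sub_cancel_left, norm_smul, Real.norm_eq_abs, abs_of_pos hρ]
    have : ‖y‖ ≤ 1 := by simpa using hy
    nlinarith
  · -- `V'` is `C²` on `U'`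
    exact hV.comp (hAc.of_le le_top).contDiffOn fun p hp => hp
  · -- `b'` is `C¹` on `U'`
    exact (hb.comp (hAc.of_le le_top).contDiffOn fun p hp => hp).const_smul ρ
  · -- drift bound
    intro s hs y hy
    rw [hb', norm_smul, Real.norm_eq_abs, abs_of_pos hρ]
    have := hbd _ (htime s hs) _ (hspace1 y hy)
    calc ρ * ‖b (t₀ + ρ ^ 2 * s) (x₀ + ρ • y)‖ ≤ ρ * (Λ / ρ) := mul_le_mul_of_nonneg_left this hρ.le
      _ = Λ := by field_simp
  · -- divergence free
    intro s hs y hy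
    rw [hb', divergence_smul_comp_affine (b (t₀ + ρ ^ 2 * s)) x₀ ρ y, hdiv _ (htime s hs) _ (hspace1 y hy), mul_zero]
  · -- nonnegativity
    intro s hs y hy
    exact hpos _ (htime s hs) _ (hspace1 y hy)
  · -- supersolution inequality: every term scales by `ρ²`
    intro s hs y hy
    have h1 : deriv (fun τ => V' τ y) s = ρ ^ 2 * deriv (fun τ => V τ (x₀ + ρ • y)) (t₀ + ρ ^ 2 * s) :=
      deriv_comp_time_affine (fun τ => V τ (x₀ + ρ • y)) t₀ (ρ ^ 2) s
    have h2 : Δ (V' s) y = ρ ^ 2 * Δ (V (t₀ + ρ ^ 2 * s)) (x₀ + ρ • y) :=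
      laplacian_comp_affine (V (t₀ + ρ ^ 2 * s)) x₀ ρ y
    have h3 : ⟪b' s y, gradient (V' s) y⟫_ℝ =
        ρ ^ 2 * ⟪b (t₀ + ρ ^ 2 * s) (x₀ + ρ • y), gradient (V (t₀ + ρ ^ 2 * s)) (x₀ + ρ • y)⟫_ℝ := by
      rw [hb', show V' s = fun y => V (t₀ + ρ ^ 2 * s) (x₀ + ρ • y) from rfl, gradient_comp_affine, inner_smul_left,
        inner_smul_right]
      simp [pow_two, mul_assoc]
    rw [h1, h2, h3]
    have := hsup _ (htime s hs) _ (hspace1 y hy)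
    nlinarith
  · -- the measure time
    rw [div_pos_iff]; left; exact ⟨by linarith, hρ2⟩
  · rw [div_lt_iff₀ hρ2]; linarith
  · -- the measure condition
    have e1 : t₀ + ρ ^ 2 * ((tbar - t₀) / ρ ^ 2) = tbar := by field_simp; ring
    have hset : {y : EuclideanSpace ℝ (Fin 3) | y ∈ Metric.ball (0 : EuclideanSpace ℝ (Fin 3)) 1 ∧ lam ≤ V' ((tbar - t₀) / ρ ^ 2) y} =
        (fun y : EuclideanSpace ℝ (Fin 3) => x₀ + ρ • y) ⁻¹' {x | x ∈ Metric.ball x₀ ρ ∧ lam ≤ V tbar x} := by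
      ext y
      simp only [mem_setOf_eq, mem_preimage]
      rw [show V' ((tbar - t₀) / ρ ^ 2) y = V tbar (x₀ + ρ • y) by simp only [hV', e1]]
      constructor
      · rintro ⟨h1, h2⟩; exact ⟨hspace1 y h1, h2⟩
      · rintro ⟨h1, h2⟩
        refine ⟨?_, h2⟩
        rw [mem_ball, dist_eq_norm, add_sub_cancel_left, norm_smul, Real.norm_eq_abs, abs_of_pos hρ] at h1
        rw [mem_ball, dist_zero_right]
        nlinarith
    rw [hset, volume_preimage_affine x₀ hρ0, abs_of_pos (pow_pos hρ 3)]
    calc ENNReal.ofReal δ = ENNReal.ofReal ((ρ ^ 3)⁻¹) * ENNReal.ofReal (δ * ρ ^ 3) := by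
          rw [← ENNReal.ofReal_mul (by positivity)]
          congr 1; field_simp
      _ ≤ ENNReal.ofReal ((ρ ^ 3)⁻¹) * volume {x | x ∈ Metric.ball x₀ ρ ∧ lam ≤ V tbar x} := by gcongr
  · -- the target time
    constructor
    · rw [lt_div_iff₀ hρ2]; linarith [ht.1]
    · rw [div_lt_iff₀ hρ2]; linarith [ht.2]
  · -- the target point
    rw [mem_ball, dist_zero_right, norm_smul, Real.norm_eq_abs, abs_inv, abs_of_pos hρ]
    rw [mem_ball, dist_eq_norm] at hx
    rw [inv_mul_lt_iff₀ hρ]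
    linarith

end Summit.NavierStokesRegularity.NavierStokesRegularity.Theorems.AveragedConeLiouville.PositivityCylinders

end
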